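import Literature.RepresentationTheory.ClassicalInvariants.OnSpDualityOperators
import Mathlib.LinearAlgebra.SymplecticGroup
import HarnessLib

/-!
# The operators `E_ij`, `S_ij`, `D_ij` of `Sp(n)`–`𝔰𝔬(2k)` Howe duality

Goodman–Wallach, *Symmetry, Representations, and Invariants* (GTM 255), § 5.6.5, Theorem 5.6.14
with its proof, (5.91)–(5.94) [GoodmanWallachGTM255]. On the polynomial ring
`𝒫(M_{2n,k}) = R[x_{ui} : u ∈ τ ⊕ τ, i ∈ ι]` (`MvPolynomial ((τ ⊕ τ) × ι) R`; the row index
`Sum.inl p` is the book's `p`, `Sum.inr p` the book's `p + n`; `τ` finite of size `n`, `ι` arbitrary)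
consider, for `i j ∈ ι`, the operators

* `E_ij = ∑_{q ∈ τ ⊕ τ} x_{qi} ∂/∂x_{qj}` (the `𝔤𝔩(k)` vector fields, over all `2n` rows),
* `S_ij =` multiplication by `ω(x_i, x_j) = ∑_p (x_{pi} x_{p+n,j} − x_{p+n,i} x_{pj})`,
* `D_ij = ∑_p (∂²/∂x_{pi}∂x_{p+n,j} − ∂²/∂x_{p+n,i}∂x_{pj})`.

As in the companion file `OnSpDualityOperators` (the orthogonal case) the operators are passed as
hypotheses (`hE`, `hS`, `hD`). Everything is proved, over an arbitrary commutative ring `R`;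
no definitions, no named facts. Kronecker deltas are written `(if i = j then (1 : R) else 0) • _`.

* § 1 `S_antisymm`, `D_antisymm`, `D_comm`, `S_mul_comm` — `S_ji = −S_ij`, `D_ij = −D_ji`,
  (5.91) `[D_ij, D_rs] = 0 = [S_ij, S_rs]`; `euler_S` — `E_ij ω(x_r,x_s) = δ_jr ω(x_i,x_s) +
  δ_js ω(x_r,x_i)`;
* § 2 the commutation relations of Theorem 5.6.14: `D_S_comm` (5.92), `euler_S_comm` (5.93),
  `euler_D_comm` (5.94), applied to a polynomial `f`, and as commutator brackets in `End_R 𝒫`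
  (`lie_D_D`, `lie_S_S`, `lie_D_S`, `lie_euler_S`, `lie_euler_D`); together with (5.81)
  (`OnSpDualityOperators.euler_euler_comm` for the row type `τ ⊕ τ`) they show that
  `Span{E_ij + nδ_ij, S_ij, D_ij}` is a Lie subalgebra of `𝔻(V)` (≅ `𝔰𝔬(2k)`);
* § 3 invariance under the left action of `Sp(n)` (Mathlib's `Matrix.symplecticGroup τ R`, the
  matrices `a` with `a J aᵀ = J`; Mathlib's `J = [[0, −1], [1, 0]]` is the negative of the book's,
  with the same isometry group) by `x ↦ a x` (`f ↦ aeval v f`, `v (u,i) = ∑_w a_{uw} x_{wi}`):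
  `aeval_linSubst_S` and `D_aeval_linSubst` (`S_ij`, `D_ij ∈ 𝔻(V)^{Sp(n)}`); `E_ij` commutes with
  all of `GL(2n)` by `OnSpDualityOperators.euler_aeval_linSubst`.

The second half of Theorem 5.6.14 (`𝔤′ ≅ 𝔰𝔬(2k)`, and `𝔤′` generates `𝔻(V)^G` via the FFT) is
not formalised here.

References: R. Goodman, N. R. Wallach, GTM 255, Springer 2009, § 5.6.5, Theorem 5.6.14,
(5.91)–(5.94) [GoodmanWallachGTM255].
-/

open MvPolynomial
open scoped BigOperators

universe u v w

namespace Literature.RepresentationTheory.ClassicalInvariants.SpSoDualityOperators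

variable {R : Type u} [CommRing R] {τ : Type v} {ι : Type w} [Fintype τ] [DecidableEq τ]
  [DecidableEq ι]

/-! ## § 0. Calculus helpers (rows indexed by `τ ⊕ τ`) -/

omit [Fintype τ] in
/-- Partial derivatives commute. [folklore] -/
private theorem pderiv_comm' (a b : (τ ⊕ τ) × ι) (f : MvPolynomial ((τ ⊕ τ) × ι) R) :
    pderiv a (pderiv b f) = pderiv b (pderiv a f) := by
  rcases eq_or_ne a b with rfl | hab
  · rfl
  ext m
  simp only [coeff_pderiv, Finsupp.add_apply, Finsupp.single_apply, if_neg hab,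
    if_neg hab.symm, add_zero]
  rw [add_right_comm m (Finsupp.single a 1) (Finsupp.single b 1)]
  ring

omit [Fintype τ] in
/-- Fourth-order commutation `∂_a ∂_b ∂_c ∂_d = ∂_c ∂_d ∂_a ∂_b`. [folklore] -/
private theorem pderiv_comm4 (a b c d : (τ ⊕ τ) × ι) (f : MvPolynomial ((τ ⊕ τ) × ι) R) :
    pderiv a (pderiv b (pderiv c (pderiv d f))) = pderiv c (pderiv d (pderiv a (pderiv b f))) := by
  rw [pderiv_comm' b c, pderiv_comm' a c, pderiv_comm' b d, pderiv_comm' a d]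

omit [Fintype τ] in
/-- `∂_{uj} x_{u's} = δ_{u'u} δ_{sj}`. [folklore] -/
private theorem pderiv_X_pair (u u' : τ ⊕ τ) (j s : ι) :
    pderiv (u, j) (X (u', s) : MvPolynomial ((τ ⊕ τ) × ι) R) = if u' = u ∧ s = j then 1 else 0 := by
  rw [pderiv_X]
  simp [Pi.single_apply, Prod.ext_iff]

omit [Fintype τ] [DecidableEq τ] [DecidableEq ι] in
/-- Second-order Leibniz rule. [folklore] -/
private theorem pderiv_pderiv_mul (a b : (τ ⊕ τ) × ι) (φ f : MvPolynomial ((τ ⊕ τ) × ι) R) :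
    pderiv a (pderiv b (φ * f)) =
      pderiv a (pderiv b φ) * f + pderiv b φ * pderiv a f + pderiv a φ * pderiv b f +
        φ * pderiv a (pderiv b f) := by
  rw [pderiv_mul, map_add, pderiv_mul, pderiv_mul]
  ring

/-- `∂_{(inl p) j} S_rs = δ_rj x_{(inr p) s} − δ_sj x_{(inr p) r}`. [folklore] -/
private theorem pderiv_inl_S (S : ι → ι → MvPolynomial ((τ ⊕ τ) × ι) R)
    (hS : ∀ i j, S i j = ∑ p : τ, (X (Sum.inl p, i) * X (Sum.inr p, j) -
      X (Sum.inr p, i) * X (Sum.inl p, j))) (p : τ) (j r s : ι) :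
    pderiv (Sum.inl p, j) (S r s) =
      (if r = j then (1 : R) else 0) • X (Sum.inr p, s) -
        (if s = j then (1 : R) else 0) • X (Sum.inr p, r) := by
  rw [hS, map_sum, Finset.sum_eq_single p]
  · rw [map_sub, pderiv_mul, pderiv_mul, pderiv_X_pair, pderiv_X_pair, pderiv_X_pair, pderiv_X_pair]
    simp only [true_and, reduceCtorEq, false_and, if_false]
    simp only [ite_mul, one_mul, zero_mul, mul_ite, mul_one, mul_zero, ite_smul, one_smul,
      zero_smul, add_zero, zero_add]
  · intro q _ hqp
    rw [map_sub, pderiv_mul, pderiv_mul, pderiv_X_pair, pderiv_X_pair, pderiv_X_pair, pderiv_X_pair,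
      if_neg (fun h => hqp (Sum.inl_injective h.1)), if_neg (fun h => Sum.inr_ne_inl h.1),
      if_neg (fun h => Sum.inr_ne_inl h.1), if_neg (fun h => hqp (Sum.inl_injective h.1))]
    ring
  · intro h; exact absurd (Finset.mem_univ p) h

/-- `∂_{(inr p) j} S_rs = δ_sj x_{(inl p) r} − δ_rj x_{(inl p) s}`. [folklore] -/
private theorem pderiv_inr_S (S : ι → ι → MvPolynomial ((τ ⊕ τ) × ι) R)
    (hS : ∀ i j, S i j = ∑ p : τ, (X (Sum.inl p, i) * X (Sum.inr p, j) -
      X (Sum.inr p, i) * X (Sum.inl p, j))) (p : τ) (j r s : ι) :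
    pderiv (Sum.inr p, j) (S r s) =
      (if s = j then (1 : R) else 0) • X (Sum.inl p, r) -
        (if r = j then (1 : R) else 0) • X (Sum.inl p, s) := by
  rw [hS, map_sum, Finset.sum_eq_single p]
  · rw [map_sub, pderiv_mul, pderiv_mul, pderiv_X_pair, pderiv_X_pair, pderiv_X_pair, pderiv_X_pair]
    simp only [true_and, reduceCtorEq, false_and, if_false]
    simp only [ite_mul, one_mul, zero_mul, mul_ite, mul_one, mul_zero, ite_smul, one_smul,
      zero_smul, add_zero, zero_add]
  · intro q _ hqp
    rw [map_sub, pderiv_mul, pderiv_mul, pderiv_X_pair, pderiv_X_pair, pderiv_X_pair, pderiv_X_pair,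
      if_neg (fun h => Sum.inl_ne_inr h.1), if_neg (fun h => hqp (Sum.inr_injective h.1)),
      if_neg (fun h => hqp (Sum.inr_injective h.1)), if_neg (fun h => Sum.inl_ne_inr h.1)]
    ring
  · intro h; exact absurd (Finset.mem_univ p) h

/-- `∂_{(inl p) i} ∂_{(inr p) j} S_rs = δ_sj δ_ri − δ_rj δ_si`. [folklore] -/
private theorem pderiv_inl_pderiv_inr_S (S : ι → ι → MvPolynomial ((τ ⊕ τ) × ι) R)
    (hS : ∀ i j, S i j = ∑ p : τ, (X (Sum.inl p, i) * X (Sum.inr p, j) -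
      X (Sum.inr p, i) * X (Sum.inl p, j))) (p : τ) (i j r s : ι) :
    pderiv (Sum.inl p, i) (pderiv (Sum.inr p, j) (S r s)) =
      ((if s = j then (1 : R) else 0) * (if r = i then (1 : R) else 0) -
        (if r = j then (1 : R) else 0) * (if s = i then (1 : R) else 0)) •
        (1 : MvPolynomial ((τ ⊕ τ) × ι) R) := by
  rw [pderiv_inr_S S hS, map_sub, Derivation.map_smul, Derivation.map_smul, pderiv_X_pair,
    pderiv_X_pair]
  simp only [true_and, sub_smul, mul_smul]
  congr 1
  · by_cases h : r = i <;> simp [h]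
  · by_cases h : s = i <;> simp [h]

/-- `∂_{(inr p) i} ∂_{(inl p) j} S_rs = δ_rj δ_si − δ_sj δ_ri`. [folklore] -/
private theorem pderiv_inr_pderiv_inl_S (S : ι → ι → MvPolynomial ((τ ⊕ τ) × ι) R)
    (hS : ∀ i j, S i j = ∑ p : τ, (X (Sum.inl p, i) * X (Sum.inr p, j) -
      X (Sum.inr p, i) * X (Sum.inl p, j))) (p : τ) (i j r s : ι) :
    pderiv (Sum.inr p, i) (pderiv (Sum.inl p, j) (S r s)) =
      ((if r = j then (1 : R) else 0) * (if s = i then (1 : R) else 0) -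
        (if s = j then (1 : R) else 0) * (if r = i then (1 : R) else 0)) •
        (1 : MvPolynomial ((τ ⊕ τ) × ι) R) := by
  rw [pderiv_inl_S S hS, map_sub, Derivation.map_smul, Derivation.map_smul, pderiv_X_pair,
    pderiv_X_pair]
  simp only [true_and, sub_smul, mul_smul]
  congr 1
  · by_cases h : s = i <;> simp [h]
  · by_cases h : r = i <;> simp [h]

omit [DecidableEq τ] [DecidableEq ι] in
/-- `E_ij` (rows `τ ⊕ τ`) is a derivation. [folklore] -/
private theorem E_mul (E : ι → ι → MvPolynomial ((τ ⊕ τ) × ι) R →ₗ[R] MvPolynomial ((τ ⊕ τ) × ι) R)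
    (hE : ∀ i j f, E i j f = ∑ q : τ ⊕ τ, X (q, i) * pderiv (q, j) f) (i j : ι)
    (g f : MvPolynomial ((τ ⊕ τ) × ι) R) : E i j (g * f) = E i j g * f + g * E i j f := by
  rw [hE, hE, hE, Finset.sum_mul, Finset.mul_sum, ← Finset.sum_add_distrib]
  refine Finset.sum_congr rfl fun q _ => ?_
  rw [pderiv_mul]; ring

/-- `E_ij x_{qs} = δ_sj x_{qi}`. [folklore] -/
private theorem E_X (E : ι → ι → MvPolynomial ((τ ⊕ τ) × ι) R →ₗ[R] MvPolynomial ((τ ⊕ τ) × ι) R)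
    (hE : ∀ i j f, E i j f = ∑ q : τ ⊕ τ, X (q, i) * pderiv (q, j) f) (i j : ι) (q : τ ⊕ τ)
    (s : ι) : E i j (X (q, s)) = (if s = j then (1 : R) else 0) • X (q, i) := by
  rw [hE, Finset.sum_eq_single q]
  · rw [pderiv_X_pair]
    simp only [true_and, mul_ite, mul_one, mul_zero, ite_smul, one_smul, zero_smul]
  · intro q' _ hq'
    rw [pderiv_X_pair, if_neg (fun h => hq' h.1.symm), mul_zero]
  · intro h; exact absurd (Finset.mem_univ q) h

omit [DecidableEq τ] [DecidableEq ι] in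
/-- `E_ij` split along the two row blocks. [folklore] -/
private theorem E_eq_sum (E : ι → ι → MvPolynomial ((τ ⊕ τ) × ι) R →ₗ[R] MvPolynomial ((τ ⊕ τ) × ι) R)
    (hE : ∀ i j f, E i j f = ∑ q : τ ⊕ τ, X (q, i) * pderiv (q, j) f) (i j : ι)
    (f : MvPolynomial ((τ ⊕ τ) × ι) R) :
    E i j f = ∑ p : τ, (X (Sum.inl p, i) * pderiv (Sum.inl p, j) f +
      X (Sum.inr p, i) * pderiv (Sum.inr p, j) f) := by
  rw [hE, Fintype.sum_sum_type, Finset.sum_add_distrib]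

/-- `E_ij (ω(x_r, x_s)) = δ_jr ω(x_i, x_s) + δ_js ω(x_r, x_i)`.
[cite: GoodmanWallachGTM255, Theorem 5.6.14 (proof, display preceding (5.93))] -/
theorem euler_S (E : ι → ι → MvPolynomial ((τ ⊕ τ) × ι) R →ₗ[R] MvPolynomial ((τ ⊕ τ) × ι) R)
    (hE : ∀ i j f, E i j f = ∑ q : τ ⊕ τ, X (q, i) * pderiv (q, j) f)
    (S : ι → ι → MvPolynomial ((τ ⊕ τ) × ι) R)
    (hS : ∀ i j, S i j = ∑ p : τ, (X (Sum.inl p, i) * X (Sum.inr p, j) -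
      X (Sum.inr p, i) * X (Sum.inl p, j))) (i j r s : ι) :
    E i j (S r s) = (if r = j then (1 : R) else 0) • S i s + (if s = j then (1 : R) else 0) • S r i := by
  rw [hS r s, map_sum]
  simp_rw [map_sub, E_mul E hE, E_X E hE]
  rw [hS i s, hS r i, Finset.smul_sum, Finset.smul_sum, ← Finset.sum_add_distrib]
  refine Finset.sum_congr rfl fun p _ => ?_
  simp only [smul_sub, smul_mul_assoc, mul_smul_comm]
  abel

/-! ## § 1. Antisymmetry and (5.91) -/

omit [Fintype τ] [DecidableEq τ] [DecidableEq ι] in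
/-- `S_ji = −S_ij`. [cite: GoodmanWallachGTM255, §5.6.5 ("Note that D_ij = −D_ji and S_ji = −S_ij")] -/
theorem S_antisymm [Fintype τ] (S : ι → ι → MvPolynomial ((τ ⊕ τ) × ι) R)
    (hS : ∀ i j, S i j = ∑ p : τ, (X (Sum.inl p, i) * X (Sum.inr p, j) -
      X (Sum.inr p, i) * X (Sum.inl p, j))) (i j : ι) : S j i = -S i j := by
  rw [hS, hS, ← Finset.sum_neg_distrib]
  exact Finset.sum_congr rfl fun p _ => by ring

omit [DecidableEq τ] [DecidableEq ι] in
/-- `D_ij = −D_ji`. [cite: GoodmanWallachGTM255, §5.6.5 ("Note that D_ij = −D_ji and S_ji = −S_ij")] -/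
theorem D_antisymm (D : ι → ι → MvPolynomial ((τ ⊕ τ) × ι) R →ₗ[R] MvPolynomial ((τ ⊕ τ) × ι) R)
    (hD : ∀ i j f, D i j f = ∑ p : τ, (pderiv (Sum.inl p, i) (pderiv (Sum.inr p, j) f) -
      pderiv (Sum.inr p, i) (pderiv (Sum.inl p, j) f))) (i j : ι)
    (f : MvPolynomial ((τ ⊕ τ) × ι) R) : D j i f = -D i j f := by
  classical
  rw [hD, hD, ← Finset.sum_neg_distrib]
  refine Finset.sum_congr rfl fun p _ => ?_
  rw [pderiv_comm' (Sum.inl p, j), pderiv_comm' (Sum.inr p, j), neg_sub]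

omit [DecidableEq τ] [DecidableEq ι] in
/-- **(5.91), first relation** `[D_ij, D_rs] = 0`.
[cite: GoodmanWallachGTM255, Theorem 5.6.14 (proof, (5.91))] -/
theorem D_comm (D : ι → ι → MvPolynomial ((τ ⊕ τ) × ι) R →ₗ[R] MvPolynomial ((τ ⊕ τ) × ι) R)
    (hD : ∀ i j f, D i j f = ∑ p : τ, (pderiv (Sum.inl p, i) (pderiv (Sum.inr p, j) f) -
      pderiv (Sum.inr p, i) (pderiv (Sum.inl p, j) f))) (i j r s : ι)
    (f : MvPolynomial ((τ ⊕ τ) × ι) R) : D i j (D r s f) = D r s (D i j f) := by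
  classical
  rw [hD i j, hD r s f, hD r s, hD i j f]
  simp_rw [map_sum, map_sub, ← Finset.sum_sub_distrib]
  rw [Finset.sum_comm]
  refine Finset.sum_congr rfl fun q _ => Finset.sum_congr rfl fun p _ => ?_
  rw [pderiv_comm4 (Sum.inl p, i) (Sum.inr p, j) (Sum.inl q, r) (Sum.inr q, s),
    pderiv_comm4 (Sum.inl p, i) (Sum.inr p, j) (Sum.inr q, r) (Sum.inl q, s),
    pderiv_comm4 (Sum.inr p, i) (Sum.inl p, j) (Sum.inl q, r) (Sum.inr q, s),
    pderiv_comm4 (Sum.inr p, i) (Sum.inl p, j) (Sum.inr q, r) (Sum.inl q, s)]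
  abel

omit [Fintype τ] [DecidableEq τ] [DecidableEq ι] in
/-- **(5.91), second relation** `[S_ij, S_rs] = 0` (multiplication operators commute).
[cite: GoodmanWallachGTM255, Theorem 5.6.14 (proof, (5.91))] -/
theorem S_mul_comm (S : ι → ι → MvPolynomial ((τ ⊕ τ) × ι) R) (i j r s : ι)
    (f : MvPolynomial ((τ ⊕ τ) × ι) R) : S i j * (S r s * f) = S r s * (S i j * f) := by
  ring

/-! ## § 2. The commutation relations (5.92)–(5.94) -/

/-- **(5.92)** `[D_ij, S_rs] = δ_ri E_sj − δ_rj E_si + δ_sj E_ri − δ_si E_rj + 2n(δ_ri δ_sj − δ_rj δ_si)`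
(the book writes the scalar as `n` distributed over the four shifted operators `E_ab + nδ_ab`;
here `E_ab = ∑_{q ∈ τ ⊕ τ} x_{qa} ∂_{qb}` runs over all `2n` rows), applied to `f`.
[cite: GoodmanWallachGTM255, Theorem 5.6.14 (proof, (5.92))] -/
theorem D_S_comm (D : ι → ι → MvPolynomial ((τ ⊕ τ) × ι) R →ₗ[R] MvPolynomial ((τ ⊕ τ) × ι) R)
    (hD : ∀ i j f, D i j f = ∑ p : τ, (pderiv (Sum.inl p, i) (pderiv (Sum.inr p, j) f) -
      pderiv (Sum.inr p, i) (pderiv (Sum.inl p, j) f)))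
    (S : ι → ι → MvPolynomial ((τ ⊕ τ) × ι) R)
    (hS : ∀ i j, S i j = ∑ p : τ, (X (Sum.inl p, i) * X (Sum.inr p, j) -
      X (Sum.inr p, i) * X (Sum.inl p, j)))
    (E : ι → ι → MvPolynomial ((τ ⊕ τ) × ι) R →ₗ[R] MvPolynomial ((τ ⊕ τ) × ι) R)
    (hE : ∀ i j f, E i j f = ∑ q : τ ⊕ τ, X (q, i) * pderiv (q, j) f) (i j r s : ι)
    (f : MvPolynomial ((τ ⊕ τ) × ι) R) :
    D i j (S r s * f) - S r s * D i j f =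
      (if r = i then (1 : R) else 0) • E s j f - (if r = j then (1 : R) else 0) • E s i f +
        (if s = j then (1 : R) else 0) • E r i f - (if s = i then (1 : R) else 0) • E r j f +
        (2 * (Fintype.card τ : R) * ((if r = i then (1 : R) else 0) * (if s = j then (1 : R) else 0) -
          (if r = j then (1 : R) else 0) * (if s = i then (1 : R) else 0))) • f := by
  have hp : ∀ p : τ,
      (pderiv (Sum.inl p, i) (pderiv (Sum.inr p, j) (S r s * f)) -
          pderiv (Sum.inr p, i) (pderiv (Sum.inl p, j) (S r s * f))) -
        S r s * (pderiv (Sum.inl p, i) (pderiv (Sum.inr p, j) f) -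
          pderiv (Sum.inr p, i) (pderiv (Sum.inl p, j) f)) =
      (if r = i then (1 : R) else 0) •
          (X (Sum.inl p, s) * pderiv (Sum.inl p, j) f + X (Sum.inr p, s) * pderiv (Sum.inr p, j) f) -
        (if r = j then (1 : R) else 0) •
          (X (Sum.inl p, s) * pderiv (Sum.inl p, i) f + X (Sum.inr p, s) * pderiv (Sum.inr p, i) f) +
        (if s = j then (1 : R) else 0) •
          (X (Sum.inl p, r) * pderiv (Sum.inl p, i) f + X (Sum.inr p, r) * pderiv (Sum.inr p, i) f) -
        (if s = i then (1 : R) else 0) •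
          (X (Sum.inl p, r) * pderiv (Sum.inl p, j) f + X (Sum.inr p, r) * pderiv (Sum.inr p, j) f) +
        (2 * ((if r = i then (1 : R) else 0) * (if s = j then (1 : R) else 0) -
          (if r = j then (1 : R) else 0) * (if s = i then (1 : R) else 0))) • f := by
    intro p
    rw [pderiv_pderiv_mul, pderiv_pderiv_mul, pderiv_inl_pderiv_inr_S S hS,
      pderiv_inr_pderiv_inl_S S hS, pderiv_inl_S S hS, pderiv_inr_S S hS, pderiv_inl_S S hS,
      pderiv_inr_S S hS]
    simp only [Algebra.smul_def, map_sub, map_mul, map_ofNat]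
    ring
  rw [hD, hD i j f, Finset.mul_sum, ← Finset.sum_sub_distrib]
  simp_rw [hp]
  simp only [Finset.sum_add_distrib, Finset.sum_sub_distrib, ← Finset.smul_sum, ← E_eq_sum E hE,
    Finset.sum_const, Finset.card_univ, ← Nat.cast_smul_eq_nsmul R, smul_smul]
  congr 2
  ring

/-- **(5.93)** `[E_ij, S_rs] = δ_jr S_is + δ_js S_ri` (the shift `nδ_ij` commutes with `S_rs`),
applied to `f`. [cite: GoodmanWallachGTM255, Theorem 5.6.14 (proof, (5.93))] -/
theorem euler_S_comm (E : ι → ι → MvPolynomial ((τ ⊕ τ) × ι) R →ₗ[R] MvPolynomial ((τ ⊕ τ) × ι) R)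
    (hE : ∀ i j f, E i j f = ∑ q : τ ⊕ τ, X (q, i) * pderiv (q, j) f)
    (S : ι → ι → MvPolynomial ((τ ⊕ τ) × ι) R)
    (hS : ∀ i j, S i j = ∑ p : τ, (X (Sum.inl p, i) * X (Sum.inr p, j) -
      X (Sum.inr p, i) * X (Sum.inl p, j))) (i j r s : ι)
    (f : MvPolynomial ((τ ⊕ τ) × ι) R) :
    E i j (S r s * f) - S r s * E i j f =
      ((if r = j then (1 : R) else 0) • S i s + (if s = j then (1 : R) else 0) • S r i) * f := by
  rw [E_mul E hE, euler_S E hE S hS]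
  ring

/-- **(5.94)** `[E_ij, D_rs] = −δ_ir D_js + δ_is D_jr` (the shift `nδ_ij` commutes with `D_rs`),
applied to `f`. [cite: GoodmanWallachGTM255, Theorem 5.6.14 (proof, (5.94))] -/
theorem euler_D_comm (D : ι → ι → MvPolynomial ((τ ⊕ τ) × ι) R →ₗ[R] MvPolynomial ((τ ⊕ τ) × ι) R)
    (hD : ∀ i j f, D i j f = ∑ p : τ, (pderiv (Sum.inl p, i) (pderiv (Sum.inr p, j) f) -
      pderiv (Sum.inr p, i) (pderiv (Sum.inl p, j) f)))
    (E : ι → ι → MvPolynomial ((τ ⊕ τ) × ι) R →ₗ[R] MvPolynomial ((τ ⊕ τ) × ι) R)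
    (hE : ∀ i j f, E i j f = ∑ q : τ ⊕ τ, X (q, i) * pderiv (q, j) f) (i j r s : ι)
    (f : MvPolynomial ((τ ⊕ τ) × ι) R) :
    E i j (D r s f) - D r s (E i j f) =
      -((if i = r then (1 : R) else 0) • D j s f) + (if i = s then (1 : R) else 0) • D j r f := by
  -- the generic second-order piece `∑_q ∂_a ∂_b (x_{qi} ∂_{qj} f)`
  have G : ∀ (ua ub : τ ⊕ τ) (ja jb : ι),
      ∑ q : τ ⊕ τ, pderiv (ua, ja) (pderiv (ub, jb) (X (q, i) * pderiv (q, j) f)) =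
        (if i = jb then (1 : R) else 0) • pderiv (ua, ja) (pderiv (ub, j) f) +
          (if i = ja then (1 : R) else 0) • pderiv (ub, jb) (pderiv (ua, j) f) +
          ∑ q : τ ⊕ τ, X (q, i) * pderiv (q, j) (pderiv (ua, ja) (pderiv (ub, jb) f)) := by
    intro ua ub ja jb
    simp_rw [pderiv_pderiv_mul]
    rw [Finset.sum_add_distrib, Finset.sum_add_distrib, Finset.sum_add_distrib]
    have t1 : ∑ q : τ ⊕ τ, pderiv (ua, ja) (pderiv (ub, jb) (X (q, i))) * pderiv (q, j) f = 0 := by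
      refine Finset.sum_eq_zero fun q _ => ?_
      rw [pderiv_X_pair]
      split_ifs <;> simp
    have t2 : ∑ q : τ ⊕ τ, pderiv (ub, jb) (X (q, i)) * pderiv (ua, ja) (pderiv (q, j) f) =
        (if i = jb then (1 : R) else 0) • pderiv (ua, ja) (pderiv (ub, j) f) := by
      rw [Finset.sum_eq_single ub]
      · rw [pderiv_X_pair]
        simp only [true_and, ite_mul, one_mul, zero_mul, ite_smul, one_smul, zero_smul]
      · intro q _ hq
        rw [pderiv_X_pair, if_neg (fun h => hq h.1), zero_mul]
      · intro h; exact absurd (Finset.mem_univ ub) h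
    have t3 : ∑ q : τ ⊕ τ, pderiv (ua, ja) (X (q, i)) * pderiv (ub, jb) (pderiv (q, j) f) =
        (if i = ja then (1 : R) else 0) • pderiv (ub, jb) (pderiv (ua, j) f) := by
      rw [Finset.sum_eq_single ua]
      · rw [pderiv_X_pair]
        simp only [true_and, ite_mul, one_mul, zero_mul, ite_smul, one_smul, zero_smul]
      · intro q _ hq
        rw [pderiv_X_pair, if_neg (fun h => hq h.1), zero_mul]
      · intro h; exact absurd (Finset.mem_univ ua) h
    have t4 : ∑ q : τ ⊕ τ, X (q, i) * pderiv (ua, ja) (pderiv (ub, jb) (pderiv (q, j) f)) =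
        ∑ q : τ ⊕ τ, X (q, i) * pderiv (q, j) (pderiv (ua, ja) (pderiv (ub, jb) f)) := by
      refine Finset.sum_congr rfl fun q _ => ?_
      rw [pderiv_comm' (ub, jb) (q, j), pderiv_comm' (ua, ja) (q, j)]
    rw [t1, t2, t3, t4, zero_add]
  have key : D r s (E i j f) =
      (if i = s then (1 : R) else 0) • D r j f - (if i = r then (1 : R) else 0) • D s j f +
        E i j (D r s f) := by
    rw [hE i j f, hD r s]
    simp_rw [map_sum, G]
    rw [hE i j (D r s f), hD r j f, hD s j f, hD r s f, Finset.smul_sum, Finset.smul_sum]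
    have h3 : ∑ q : τ ⊕ τ, X (q, i) * pderiv (q, j) (∑ p : τ,
        (pderiv (Sum.inl p, r) (pderiv (Sum.inr p, s) f) - pderiv (Sum.inr p, r) (pderiv (Sum.inl p, s) f))) =
        ∑ p : τ, (∑ q : τ ⊕ τ, X (q, i) * pderiv (q, j) (pderiv (Sum.inl p, r) (pderiv (Sum.inr p, s) f)) -
          ∑ q : τ ⊕ τ, X (q, i) * pderiv (q, j) (pderiv (Sum.inr p, r) (pderiv (Sum.inl p, s) f))) := by
      simp_rw [map_sum, map_sub, Finset.mul_sum, mul_sub, Finset.sum_sub_distrib]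
      congr 1 <;> exact Finset.sum_comm
    rw [h3, ← Finset.sum_sub_distrib, ← Finset.sum_add_distrib]
    refine Finset.sum_congr rfl fun p _ => ?_
    rw [smul_sub, smul_sub]
    abel
  rw [key, D_antisymm D hD s j, D_antisymm D hD r j]
  simp only [smul_neg]
  abel

/-! ### The relations as brackets in `End_R 𝒫(M_{2n,k})` -/

omit [DecidableEq τ] [DecidableEq ι] in
/-- (5.91) as brackets: `⁅D_ij, D_rs⁆ = 0`. [cite: GoodmanWallachGTM255, Theorem 5.6.14 (proof, (5.91))] -/
theorem lie_D_D (D : ι → ι → MvPolynomial ((τ ⊕ τ) × ι) R →ₗ[R] MvPolynomial ((τ ⊕ τ) × ι) R)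
    (hD : ∀ i j f, D i j f = ∑ p : τ, (pderiv (Sum.inl p, i) (pderiv (Sum.inr p, j) f) -
      pderiv (Sum.inr p, i) (pderiv (Sum.inl p, j) f))) (i j r s : ι) :
    ⁅D i j, D r s⁆ = 0 := by
  refine LinearMap.ext fun f => ?_
  rw [Ring.lie_def, LinearMap.sub_apply, Module.End.mul_apply, Module.End.mul_apply,
    D_comm D hD, sub_self, LinearMap.zero_apply]

omit [Fintype τ] [DecidableEq τ] [DecidableEq ι] in
/-- (5.91) as brackets: `⁅S_ij, S_rs⁆ = 0`. [cite: GoodmanWallachGTM255, Theorem 5.6.14 (proof, (5.91))] -/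
theorem lie_S_S (S : ι → ι → MvPolynomial ((τ ⊕ τ) × ι) R) (i j r s : ι) :
    ⁅LinearMap.mulLeft R (S i j), LinearMap.mulLeft R (S r s)⁆ = 0 := by
  refine LinearMap.ext fun f => ?_
  rw [Ring.lie_def, LinearMap.sub_apply, Module.End.mul_apply, Module.End.mul_apply,
    LinearMap.mulLeft_apply, LinearMap.mulLeft_apply, LinearMap.mulLeft_apply,
    LinearMap.mulLeft_apply, S_mul_comm, sub_self, LinearMap.zero_apply]

/-- **(5.92) as a bracket**. [cite: GoodmanWallachGTM255, Theorem 5.6.14 (proof, (5.92))] -/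
theorem lie_D_S (D : ι → ι → MvPolynomial ((τ ⊕ τ) × ι) R →ₗ[R] MvPolynomial ((τ ⊕ τ) × ι) R)
    (hD : ∀ i j f, D i j f = ∑ p : τ, (pderiv (Sum.inl p, i) (pderiv (Sum.inr p, j) f) -
      pderiv (Sum.inr p, i) (pderiv (Sum.inl p, j) f)))
    (S : ι → ι → MvPolynomial ((τ ⊕ τ) × ι) R)
    (hS : ∀ i j, S i j = ∑ p : τ, (X (Sum.inl p, i) * X (Sum.inr p, j) -
      X (Sum.inr p, i) * X (Sum.inl p, j)))
    (E : ι → ι → MvPolynomial ((τ ⊕ τ) × ι) R →ₗ[R] MvPolynomial ((τ ⊕ τ) × ι) R)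
    (hE : ∀ i j f, E i j f = ∑ q : τ ⊕ τ, X (q, i) * pderiv (q, j) f) (i j r s : ι) :
    ⁅D i j, LinearMap.mulLeft R (S r s)⁆ =
      (if r = i then (1 : R) else 0) • E s j - (if r = j then (1 : R) else 0) • E s i +
        (if s = j then (1 : R) else 0) • E r i - (if s = i then (1 : R) else 0) • E r j +
        (2 * (Fintype.card τ : R) * ((if r = i then (1 : R) else 0) * (if s = j then (1 : R) else 0) -
          (if r = j then (1 : R) else 0) * (if s = i then (1 : R) else 0))) •
          (1 : MvPolynomial ((τ ⊕ τ) × ι) R →ₗ[R] MvPolynomial ((τ ⊕ τ) × ι) R) := by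
  refine LinearMap.ext fun f => ?_
  rw [Ring.lie_def, LinearMap.sub_apply, Module.End.mul_apply, Module.End.mul_apply,
    LinearMap.mulLeft_apply, LinearMap.mulLeft_apply, D_S_comm D hD S hS E hE]
  simp only [LinearMap.add_apply, LinearMap.sub_apply, LinearMap.smul_apply, Module.End.one_apply]

/-- **(5.93) as a bracket**. [cite: GoodmanWallachGTM255, Theorem 5.6.14 (proof, (5.93))] -/
theorem lie_euler_S (E : ι → ι → MvPolynomial ((τ ⊕ τ) × ι) R →ₗ[R] MvPolynomial ((τ ⊕ τ) × ι) R)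
    (hE : ∀ i j f, E i j f = ∑ q : τ ⊕ τ, X (q, i) * pderiv (q, j) f)
    (S : ι → ι → MvPolynomial ((τ ⊕ τ) × ι) R)
    (hS : ∀ i j, S i j = ∑ p : τ, (X (Sum.inl p, i) * X (Sum.inr p, j) -
      X (Sum.inr p, i) * X (Sum.inl p, j))) (i j r s : ι) :
    ⁅E i j, LinearMap.mulLeft R (S r s)⁆ =
      (if r = j then (1 : R) else 0) • LinearMap.mulLeft R (S i s) +
        (if s = j then (1 : R) else 0) • LinearMap.mulLeft R (S r i) := by
  refine LinearMap.ext fun f => ?_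
  rw [Ring.lie_def, LinearMap.sub_apply, Module.End.mul_apply, Module.End.mul_apply,
    LinearMap.mulLeft_apply, LinearMap.mulLeft_apply, euler_S_comm E hE S hS]
  simp only [LinearMap.add_apply, LinearMap.smul_apply, LinearMap.mulLeft_apply, add_mul,
    smul_mul_assoc]

/-- **(5.94) as a bracket**. [cite: GoodmanWallachGTM255, Theorem 5.6.14 (proof, (5.94))] -/
theorem lie_euler_D (D : ι → ι → MvPolynomial ((τ ⊕ τ) × ι) R →ₗ[R] MvPolynomial ((τ ⊕ τ) × ι) R)
    (hD : ∀ i j f, D i j f = ∑ p : τ, (pderiv (Sum.inl p, i) (pderiv (Sum.inr p, j) f) -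
      pderiv (Sum.inr p, i) (pderiv (Sum.inl p, j) f)))
    (E : ι → ι → MvPolynomial ((τ ⊕ τ) × ι) R →ₗ[R] MvPolynomial ((τ ⊕ τ) × ι) R)
    (hE : ∀ i j f, E i j f = ∑ q : τ ⊕ τ, X (q, i) * pderiv (q, j) f) (i j r s : ι) :
    ⁅E i j, D r s⁆ = -((if i = r then (1 : R) else 0) • D j s) + (if i = s then (1 : R) else 0) • D j r := by
  refine LinearMap.ext fun f => ?_
  rw [Ring.lie_def, LinearMap.sub_apply, Module.End.mul_apply, Module.End.mul_apply,
    euler_D_comm D hD E hE, LinearMap.add_apply, LinearMap.neg_apply, LinearMap.smul_apply,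
    LinearMap.smul_apply]

/-! ## § 3. Invariance under `Sp(n)` acting on the left index -/

/-- Row relations of a symplectic matrix: `∑_p (a_{u,p} a_{u',p+n} − a_{u,p+n} a_{u',p}) = −J_{uu'}`
(`a J aᵀ = J` for Mathlib's `J = [[0, −1], [1, 0]]`, the negative of the book's `J`). [folklore] -/
private theorem symplectic_row (a : Matrix (τ ⊕ τ) (τ ⊕ τ) R) (ha : a ∈ Matrix.symplecticGroup τ R)
    (u u' : τ ⊕ τ) :
    ∑ p : τ, (a u (Sum.inl p) * a u' (Sum.inr p) - a u (Sum.inr p) * a u' (Sum.inl p)) =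
      -Matrix.J τ R u u' := by
  rw [SymplecticGroup.mem_iff] at ha
  have h := congrFun (congrFun ha u) u'
  rw [← h]
  simp only [Matrix.mul_apply, Matrix.transpose_apply, Matrix.J, Fintype.sum_sum_type,
    Matrix.fromBlocks_apply₁₁, Matrix.fromBlocks_apply₁₂, Matrix.fromBlocks_apply₂₁,
    Matrix.fromBlocks_apply₂₂, Matrix.zero_apply, Matrix.neg_apply, Matrix.one_apply, mul_zero,
    Finset.sum_const_zero, zero_add, add_zero, mul_ite, mul_one, mul_neg,
    Finset.sum_ite_eq', Finset.mem_univ, if_true, Finset.sum_neg_distrib,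
    Finset.sum_sub_distrib, neg_mul]
  ring

/-- Column relations of a symplectic matrix: `∑_p (a_{p,w} a_{p+n,w'} − a_{p+n,w} a_{p,w'}) = −J_{ww'}`
(from `aᵀ J a = J`). [folklore] -/
private theorem symplectic_col (a : Matrix (τ ⊕ τ) (τ ⊕ τ) R) (ha : a ∈ Matrix.symplecticGroup τ R)
    (w w' : τ ⊕ τ) :
    ∑ p : τ, (a (Sum.inl p) w * a (Sum.inr p) w' - a (Sum.inr p) w * a (Sum.inl p) w') =
      -Matrix.J τ R w w' := by
  have hT := SymplecticGroup.transpose_mem ha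
  have := symplectic_row a.transpose hT w w'
  simpa [Matrix.transpose_apply] using this

omit [Fintype τ] [DecidableEq τ] [DecidableEq ι] in
/-- `C` commutes with `if`. [folklore] -/
private theorem C_ite (P : Prop) [Decidable P] (x y : R) :
    (C (if P then x else y) : MvPolynomial ((τ ⊕ τ) × ι) R) = if P then C x else C y := by
  split_ifs <;> rfl

omit [Fintype τ] in
/-- The entries of `−J`: `−J_{(inl p)(inr p')} = δ_{pp'}`, `−J_{(inr p)(inl p')} = −δ_{pp'}`, the
diagonal blocks vanish. [folklore] -/
private theorem neg_J_apply (u u' : τ ⊕ τ) :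
    -Matrix.J τ R u u' = match u, u' with
      | Sum.inl p, Sum.inr p' => if p = p' then 1 else 0
      | Sum.inr p, Sum.inl p' => -(if p = p' then 1 else 0)
      | Sum.inl _, Sum.inl _ => 0
      | Sum.inr _, Sum.inr _ => 0 := by
  rcases u with p | p <;> rcases u' with p' | p' <;>
    simp [Matrix.J, Matrix.fromBlocks_apply₁₁, Matrix.fromBlocks_apply₁₂, Matrix.fromBlocks_apply₂₁,
      Matrix.fromBlocks_apply₂₂, Matrix.one_apply]

omit [DecidableEq ι] in
/-- **`S_ij` is `Sp(n)`-invariant**: `ω(x_i, x_j)(a x) = ω(x_i, x_j)(x)` for `a ∈ Sp(n)`.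
[cite: GoodmanWallachGTM255, §5.6.5 ("S_ij is multiplication by the G-invariant function ω(x_i, x_j)")] -/
theorem aeval_linSubst_S (S : ι → ι → MvPolynomial ((τ ⊕ τ) × ι) R)
    (hS : ∀ i j, S i j = ∑ p : τ, (X (Sum.inl p, i) * X (Sum.inr p, j) -
      X (Sum.inr p, i) * X (Sum.inl p, j))) (a : Matrix (τ ⊕ τ) (τ ⊕ τ) R)
    (ha : a ∈ Matrix.symplecticGroup τ R) (v : (τ ⊕ τ) × ι → MvPolynomial ((τ ⊕ τ) × ι) R)
    (hv : ∀ u i, v (u, i) = ∑ w : τ ⊕ τ, C (a u w) * X (w, i)) (i j : ι) :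
    aeval v (S i j) = S i j := by
  rw [hS, map_sum]
  simp_rw [map_sub, map_mul, aeval_X, hv]
  -- expand: `∑_p (v_{inl p,i} v_{inr p,j} − v_{inr p,i} v_{inl p,j}) = ∑_{w,w'} (−(aᵀJa))_{ww'} x_{wi} x_{w'j}`
  calc ∑ p : τ, ((∑ w : τ ⊕ τ, C (a (Sum.inl p) w) * X (w, i)) * (∑ w' : τ ⊕ τ, C (a (Sum.inr p) w') * X (w', j)) -
          (∑ w : τ ⊕ τ, C (a (Sum.inr p) w) * X (w, i)) * (∑ w' : τ ⊕ τ, C (a (Sum.inl p) w') * X (w', j)))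
      = ∑ p : τ, ∑ w : τ ⊕ τ, ∑ w' : τ ⊕ τ,
          C (a (Sum.inl p) w * a (Sum.inr p) w' - a (Sum.inr p) w * a (Sum.inl p) w') *
            (X (w, i) * X (w', j)) := by
        refine Finset.sum_congr rfl fun p _ => ?_
        rw [Finset.sum_mul_sum, Finset.sum_mul_sum, ← Finset.sum_sub_distrib]
        refine Finset.sum_congr rfl fun w _ => ?_
        rw [← Finset.sum_sub_distrib]
        refine Finset.sum_congr rfl fun w' _ => ?_
        simp only [map_sub, map_mul]
        ring
    _ = ∑ w : τ ⊕ τ, ∑ w' : τ ⊕ τ, C (-Matrix.J τ R w w') * (X (w, i) * X (w', j)) := by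
        rw [Finset.sum_comm]
        refine Finset.sum_congr rfl fun w _ => ?_
        rw [Finset.sum_comm]
        refine Finset.sum_congr rfl fun w' _ => ?_
        rw [← Finset.sum_mul, ← map_sum, symplectic_col a ha]
    _ = ∑ p : τ, (X (Sum.inl p, i) * X (Sum.inr p, j) - X (Sum.inr p, i) * X (Sum.inl p, j)) := by
        simp_rw [neg_J_apply]
        rw [Fintype.sum_sum_type]
        simp_rw [Fintype.sum_sum_type]
        simp only [map_zero, zero_mul, Finset.sum_const_zero, zero_add, add_zero, map_neg,
          C_ite, map_one, ite_mul, one_mul, neg_mul, Finset.sum_ite_eq,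
          Finset.mem_univ, if_true, Finset.sum_neg_distrib, Finset.sum_sub_distrib]
        ring

/-- **`D_ij` is `Sp(n)`-invariant**: `D_ij (f(a x)) = (D_ij f)(a x)` for `a ∈ Sp(n)`
(`ρ(g) D_ij ρ(g⁻¹) = D_ij`, "a calculation like that done in Section 5.6.3").
[cite: GoodmanWallachGTM255, §5.6.5 (display preceding Theorem 5.6.14)] -/
theorem D_aeval_linSubst
    (D : ι → ι → MvPolynomial ((τ ⊕ τ) × ι) R →ₗ[R] MvPolynomial ((τ ⊕ τ) × ι) R)
    (hD : ∀ i j f, D i j f = ∑ p : τ, (pderiv (Sum.inl p, i) (pderiv (Sum.inr p, j) f) -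
      pderiv (Sum.inr p, i) (pderiv (Sum.inl p, j) f))) (a : Matrix (τ ⊕ τ) (τ ⊕ τ) R)
    (ha : a ∈ Matrix.symplecticGroup τ R) (v : (τ ⊕ τ) × ι → MvPolynomial ((τ ⊕ τ) × ι) R)
    (hv : ∀ u i, v (u, i) = ∑ w : τ ⊕ τ, C (a u w) * X (w, i)) (i j : ι)
    (f : MvPolynomial ((τ ⊕ τ) × ι) R) : D i j (aeval v f) = aeval v (D i j f) := by
  have hv' : ∀ (p : τ ⊕ τ) (i : ι), v (p, i) = ∑ q : τ ⊕ τ, C (a p q) * X (q, i) := hv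
  rw [hD, hD, map_sum]
  simp_rw [map_sub, OnSpDualityOperators.pderiv_aeval_linSubst a v hv', map_sum, pderiv_C_mul,
    OnSpDualityOperators.pderiv_aeval_linSubst a v hv', Finset.mul_sum]
  -- `∑_p ∑_u ∑_u' (a_{u,inl p} a_{u',inr p} − a_{u,inr p} a_{u',inl p}) (∂_{u'i} ∂_{uj} f)(ax)`
  calc ∑ p : τ, (∑ u : τ ⊕ τ, ∑ u' : τ ⊕ τ, C (a u (Sum.inr p)) *
            (C (a u' (Sum.inl p)) * aeval v (pderiv (u', i) (pderiv (u, j) f))) -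
          ∑ u : τ ⊕ τ, ∑ u' : τ ⊕ τ, C (a u (Sum.inl p)) *
            (C (a u' (Sum.inr p)) * aeval v (pderiv (u', i) (pderiv (u, j) f))))
      = ∑ u : τ ⊕ τ, ∑ u' : τ ⊕ τ,
          C (∑ p : τ, (a u' (Sum.inl p) * a u (Sum.inr p) - a u' (Sum.inr p) * a u (Sum.inl p))) *
            aeval v (pderiv (u', i) (pderiv (u, j) f)) := by
        simp_rw [← Finset.sum_sub_distrib]
        rw [Finset.sum_comm]
        refine Finset.sum_congr rfl fun u _ => ?_
        rw [Finset.sum_comm]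
        refine Finset.sum_congr rfl fun u' _ => ?_
        rw [map_sum, Finset.sum_mul]
        refine Finset.sum_congr rfl fun p _ => ?_
        simp only [map_sub, map_mul]
        ring
    _ = ∑ u : τ ⊕ τ, ∑ u' : τ ⊕ τ, C (-Matrix.J τ R u' u) * aeval v (pderiv (u', i) (pderiv (u, j) f)) := by
        simp_rw [symplectic_row a ha]
    _ = ∑ p : τ, (aeval v (pderiv (Sum.inl p, i) (pderiv (Sum.inr p, j) f)) -
          aeval v (pderiv (Sum.inr p, i) (pderiv (Sum.inl p, j) f))) := by
        simp_rw [neg_J_apply]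
        rw [Fintype.sum_sum_type]
        simp_rw [Fintype.sum_sum_type]
        simp only [map_zero, zero_mul, Finset.sum_const_zero, zero_add, add_zero, map_neg,
          C_ite, map_one, ite_mul, one_mul, neg_mul, Finset.sum_ite_eq',
          Finset.mem_univ, if_true, Finset.sum_neg_distrib, Finset.sum_sub_distrib]
        ring

end Literature.RepresentationTheory.ClassicalInvariants.SpSoDualityOperators
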